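import Literature.Topology.FourManifolds.TrivialisedBandCut
import HarnessLib

/-!
# Cut data from a band trivialised over the circle-valued map

Topic `Literature/Topology/FourManifolds`; the form of `TrivialisedBandCut.lean` that a Seifert
surface actually satisfies. For a knot complement `X = S³ ∖ K` cut along a Seifert surface `F` no
continuous REAL collar coordinate `τ : X → ℝ` with `τ⁻¹(0) = F` exists (the meridian crosses `F`
once, so `τ` would change sign along a loop without vanishing): the collar coordinate is only the
local branch of the circle-valued map `f : X → S¹` near `f = 1`. So here the datum is `f` itself
with a trivialisation of the band `N = {f ≠ -1}` over the branch `λ = sheetLevel f (-π) ∈ (-π, π)`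
of the angle (D. Rolfsen, *Knots and Links* (1976), §5.C bicollars, §8.C):
`Ψ : L × (-1, 1) ≃ₜ N`, `L = {f = 1}`, `λ (Ψ (y, t)) = π t`. From it: the cut data
`CircleBandData.cutData : CutData f` (`Y = {f ≠ 1}`, `N = {f ≠ -1}`), its sides
`N₊ = {0 < λ} ≅ L × (0, 1)`, `N₋ = {λ < 0} ≅ L × (-1, 0)`, and the homological hypotheses of
`CutData.exists_presentation`: `N±` path connected when `L` is, `j₊`, `j₋` bijective
(re-using the interval homotopy equivalences of `TrivialisedBandCut.lean`).
Everything is proved; no named fact is introduced.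

## References

* D. Rolfsen, *Knots and Links*, Publish or Perish (1976), §5.C, §8.C. [Rolfsen1976]
* A. Hatcher, *Algebraic Topology* (2002), Cor. 2.11. [HatcherAT2002]
-/

noncomputable section

open Set Function CategoryTheory
open scoped Real Topology
open Literature.AlgebraicTopology.SingularHomology

universe u

namespace Literature.Topology.FourManifolds

namespace CircleMaps

namespace CyclicCover

variable {X : Type u} [TopologicalSpace X]

/-- **A band trivialised over the circle-valued map**: a trivialisation
`Ψ : {f = 1} × (-1, 1) ≃ₜ {f ≠ -1}` over the branch `sheetLevel f (-π) ∈ (-π, π)` of the angle,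
`sheetLevel f (-π) (Ψ (y, t)) = π t` (Rolfsen 1976, §5.C: a bicollar of the two-sided surface
`f⁻¹(1)`, its collar coordinate read as the angle of `f`). [cite: Rolfsen1976, §5.C] -/
structure CircleBandData (f : C(X, Circle)) where
  /-- the trivialisation of the band `{f ≠ -1}` -/
  Ψ : ↥{x | f x = Circle.exp 0} × Ioo (-1 : ℝ) 1 ≃ₜ ↥{x | f x ≠ Circle.exp (-π)}
  /-- it is over the branch of the angle -/
  level_Ψ : ∀ (y : ↥{x | f x = Circle.exp 0}) (t : Ioo (-1 : ℝ) 1),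
    sheetLevel f (-π) (Ψ (y, t) : X) = π * t

namespace CircleBandData

variable {f : C(X, Circle)} (B : CircleBandData f)

/-- The branch of the angle of `f` in `(-π, π]`-ish normalisation: `λ = sheetLevel f (-π)`, valued
in `(-π, π)` on the band `{f ≠ -1}`. [folklore] -/
def lam (_B : CircleBandData f) (x : X) : ℝ := sheetLevel f (-π) x

/-- On the band, `λ ∈ (-π, π)`. [folklore] -/
theorem lam_mem_Ioo {x : X} (hx : f x ≠ Circle.exp (-π)) : B.lam x ∈ Ioo (-π) π := by
  have h := sheetLevel_mem_Ioo f (-π) hx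
  show sheetLevel f (-π) x ∈ Ioo (-π) π
  exact ⟨h.1, by linarith [h.2]⟩

/-- `exp (i λ) = f`. [folklore] -/
theorem exp_lam (x : X) : Circle.exp (B.lam x) = f x := exp_sheetLevel f (-π) x

/-- On the band, `λ = 0 ↔ f = 1`. [folklore] -/
theorem lam_eq_zero_iff {x : X} (hx : f x ≠ Circle.exp (-π)) : B.lam x = 0 ↔ f x = Circle.exp 0 := by
  constructor
  · intro h
    rw [← B.exp_lam x, h]
  · intro h
    have hm := B.lam_mem_Ioo hx
    exact eq_of_exp_eq_of_mem_Ioo (b := -π) ((B.exp_lam x).trans h) ⟨hm.1, by linarith [hm.2]⟩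
      ⟨by linarith [Real.pi_pos], by linarith [Real.pi_pos]⟩

/-- **The cut data**: `Y = {f ≠ 1}`, `N = {f ≠ -1}`. [cite: Rolfsen1976, §8.C] -/
def cutData (_B : CircleBandData f) : CutData f where
  Y := {x | f x ≠ Circle.exp 0}
  N := {x | f x ≠ Circle.exp (-π)}
  isOpen_Y := isOpen_ne_fun f.continuous continuous_const
  isOpen_N := isOpen_ne_fun f.continuous continuous_const
  union_eq := by
    ext x
    simp only [mem_union, mem_setOf_eq, mem_univ, iff_true]
    by_cases h : f x = Circle.exp 0
    · right
      rw [h]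
      intro h'
      obtain ⟨m, hm⟩ := Circle.exp_eq_exp.1 h'
      have : (2 * m - 1 : ℝ) * π = 0 := by linarith
      have h2 : (2 * m - 1 : ℝ) = 0 := by
        rcases mul_eq_zero.1 this with h | h
        · exact h
        · exact absurd h Real.pi_pos.ne'
      have h3 : (2 * m - 1 : ℤ) = 0 := by exact_mod_cast h2
      omega
    · left; exact h
  ne_one x hx := hx
  ne_neg_one x hx := hx

/-- Membership in `Y`. [folklore] -/
@[simp] theorem mem_cutData_Y {x : X} : x ∈ B.cutData.Y ↔ f x ≠ Circle.exp 0 := Iff.rfl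

/-- Membership in `N`. [folklore] -/
@[simp] theorem mem_cutData_N {x : X} : x ∈ B.cutData.N ↔ f x ≠ Circle.exp (-π) := Iff.rfl

/-! ### The two sides -/

/-- On the plus part of the band the two branches agree. [folklore] -/
theorem sheetLevel_zero_eq_lam {x : X} (hx : f x ≠ Circle.exp (-π)) (hY : f x ≠ Circle.exp 0)
    (hpos : 0 < B.lam x) : sheetLevel f 0 x = B.lam x := by
  have hs := sheetLevel_mem_Ioo f 0 hY
  have hm := B.lam_mem_Ioo hx
  exact eq_of_exp_eq_of_mem_Ioo (b := 0) ((exp_sheetLevel f 0 x).trans (B.exp_lam x).symm)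
    ⟨hs.1, by linarith [hs.2]⟩ ⟨hpos, by linarith [hm.2, Real.pi_pos]⟩

/-- On the minus part the branches differ by `2π`. [folklore] -/
theorem sheetLevel_zero_eq_lam_add {x : X} (hx : f x ≠ Circle.exp (-π)) (hY : f x ≠ Circle.exp 0)
    (hneg : B.lam x < 0) : sheetLevel f 0 x = B.lam x + 2 * π := by
  have hs := sheetLevel_mem_Ioo f 0 hY
  have hm := B.lam_mem_Ioo hx
  refine eq_of_exp_eq_of_mem_Ioo (b := 0) ?_ ⟨hs.1, by linarith [hs.2]⟩
    ⟨by linarith [hm.1, Real.pi_pos], by linarith [Real.pi_pos]⟩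
  rw [exp_sheetLevel, Circle.exp_add, Circle.exp_two_pi, mul_one, B.exp_lam]

/-- **The plus side is `{x ∈ N | 0 < λ x}`.** [folklore] -/
theorem mem_plus_iff' {x : X} : x ∈ B.cutData.plus ↔ f x ≠ Circle.exp (-π) ∧ 0 < B.lam x := by
  rw [CutData.mem_plus_iff, mem_cutData_Y, mem_cutData_N]
  constructor
  · rintro ⟨⟨hY, hN⟩, hl⟩
    refine ⟨hN, ?_⟩
    rcases lt_trichotomy (B.lam x) 0 with hneg | h0 | hpos
    · rw [B.sheetLevel_zero_eq_lam_add hN hY hneg] at hl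
      have := (B.lam_mem_Ioo hN).1
      exact absurd hl (by linarith)
    · exact absurd ((B.lam_eq_zero_iff hN).1 h0) hY
    · exact hpos
  · rintro ⟨hN, hpos⟩
    have hY : f x ≠ Circle.exp 0 := fun h => hpos.ne' ((B.lam_eq_zero_iff hN).2 h)
    refine ⟨⟨hY, hN⟩, ?_⟩
    show sheetLevel f 0 x < π
    rw [B.sheetLevel_zero_eq_lam hN hY hpos]
    exact (B.lam_mem_Ioo hN).2

/-- **The minus side is `{x ∈ N | λ x < 0}`.** [folklore] -/
theorem mem_minus_iff' {x : X} : x ∈ B.cutData.minus ↔ f x ≠ Circle.exp (-π) ∧ B.lam x < 0 := by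
  rw [CutData.mem_minus_iff, mem_cutData_Y, mem_cutData_N]
  constructor
  · rintro ⟨⟨hY, hN⟩, hl⟩
    refine ⟨hN, ?_⟩
    rcases lt_trichotomy (B.lam x) 0 with hneg | h0 | hpos
    · exact hneg
    · exact absurd ((B.lam_eq_zero_iff hN).1 h0) hY
    · have hl' : π < sheetLevel f 0 x := hl
      rw [B.sheetLevel_zero_eq_lam hN hY hpos] at hl'
      have := (B.lam_mem_Ioo hN).2
      exact absurd hl' (by linarith)
  · rintro ⟨hN, hneg⟩
    have hY : f x ≠ Circle.exp 0 := fun h => hneg.ne ((B.lam_eq_zero_iff hN).2 h)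
    refine ⟨⟨hY, hN⟩, ?_⟩
    show π < sheetLevel f 0 x
    rw [B.sheetLevel_zero_eq_lam_add hN hY hneg]
    have := (B.lam_mem_Ioo hN).1
    linarith

/-! ### Coordinates on the band and its sides -/

/-- The band coordinates of a point of the band. [folklore] -/
def coordOf (x : X) (hx : f x ≠ Circle.exp (-π)) : ↥{x | f x = Circle.exp 0} × Ioo (-1 : ℝ) 1 :=
  B.Ψ.symm ⟨x, hx⟩

/-- The interval coordinate is `λ / π`. [folklore] -/
theorem pi_mul_snd_coordOf (x : X) (hx : f x ≠ Circle.exp (-π)) :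
    π * ((B.coordOf x hx).2 : ℝ) = B.lam x := by
  have h := B.level_Ψ (B.coordOf x hx).1 (B.coordOf x hx).2
  rw [Prod.mk.eta, coordOf, Homeomorph.apply_symm_apply] at h
  exact h.symm

/-- `Ψ` of the coordinates is the point. [folklore] -/
theorem Ψ_coordOf (x : X) (hx : f x ≠ Circle.exp (-π)) : (B.Ψ (B.coordOf x hx) : X) = x := by
  rw [coordOf, Homeomorph.apply_symm_apply]

/-- The coordinates of `Ψ p` are `p`. [folklore] -/
theorem coordOf_Ψ (p : ↥{x | f x = Circle.exp 0} × Ioo (-1 : ℝ) 1) (h : f (B.Ψ p : X) ≠ Circle.exp (-π)) :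
    B.coordOf (B.Ψ p) h = p := by
  rw [coordOf]
  exact (congrArg B.Ψ.symm (Subtype.ext rfl)).trans (B.Ψ.symm_apply_apply p)

/-- `λ (Ψ p) = π p.2`. [folklore] -/
theorem lam_Ψ (p : ↥{x | f x = Circle.exp 0} × Ioo (-1 : ℝ) 1) : B.lam (B.Ψ p : X) = π * p.2 := by
  have h := B.level_Ψ p.1 p.2
  rw [Prod.mk.eta] at h
  exact h

/-- **`N ≃ₜ L × (-1, 1)`.** [folklore] -/
def homeoN : ↥B.cutData.N ≃ₜ ↥{x | f x = Circle.exp 0} × Ioo (-1 : ℝ) 1 where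
  toFun x := B.coordOf x x.2
  invFun q := ⟨B.Ψ q, (B.Ψ q).2⟩
  left_inv x := Subtype.ext (B.Ψ_coordOf x _)
  right_inv q := B.coordOf_Ψ q _
  continuous_toFun := B.Ψ.symm.continuous.comp (continuous_subtype_val.subtype_mk _)
  continuous_invFun := (continuous_subtype_val.comp B.Ψ.continuous).subtype_mk _

/-- The coordinates of a point of `N₊` (interval coordinate in `(0, 1)`). [folklore] -/
def plusCoord (x : ↥B.cutData.plus) : ↥{x | f x = Circle.exp 0} × Ioo (0 : ℝ) 1 :=
  ((B.coordOf x (B.mem_plus_iff'.1 x.2).1).1,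
    ⟨(B.coordOf x (B.mem_plus_iff'.1 x.2).1).2, by
      have h := B.pi_mul_snd_coordOf x (B.mem_plus_iff'.1 x.2).1
      have hpos := (B.mem_plus_iff'.1 x.2).2
      refine ⟨?_, (B.coordOf x (B.mem_plus_iff'.1 x.2).1).2.2.2⟩
      by_contra hle
      have : π * ((B.coordOf x (B.mem_plus_iff'.1 x.2).1).2 : ℝ) ≤ 0 :=
        mul_nonpos_of_nonneg_of_nonpos Real.pi_pos.le (not_lt.1 hle)
      linarith⟩)

/-- The point of `N₊` with given coordinates. [folklore] -/
def plusPoint (q : ↥{x | f x = Circle.exp 0} × Ioo (0 : ℝ) 1) : ↥B.cutData.plus :=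
  ⟨B.Ψ (q.1, ⟨q.2.1, by linarith [q.2.2.1], q.2.2.2⟩), by
    rw [mem_plus_iff', B.lam_Ψ]
    exact ⟨(B.Ψ _).2, mul_pos Real.pi_pos q.2.2.1⟩⟩

/-- **`N₊ ≃ₜ L × (0, 1)`.** [folklore] -/
def homeoPlus : ↥B.cutData.plus ≃ₜ ↥{x | f x = Circle.exp 0} × Ioo (0 : ℝ) 1 where
  toFun := B.plusCoord
  invFun := B.plusPoint
  left_inv x := by
    apply Subtype.ext
    change (B.Ψ (_, _) : X) = x
    rw [show ((B.plusCoord x).1, (⟨((B.plusCoord x).2 : ℝ), by linarith [(B.plusCoord x).2.2.1], (B.plusCoord x).2.2.2⟩ :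
        Ioo (-1 : ℝ) 1)) = B.coordOf x (B.mem_plus_iff'.1 x.2).1 from Prod.ext rfl (Subtype.ext rfl)]
    exact B.Ψ_coordOf x _
  right_inv q := by
    have hc : B.coordOf (B.plusPoint q : X) (B.mem_plus_iff'.1 (B.plusPoint q).2).1 =
        (q.1, ⟨q.2.1, by linarith [q.2.2.1], q.2.2.2⟩) := B.coordOf_Ψ _ _
    refine Prod.ext ?_ (Subtype.ext ?_)
    · show (B.coordOf _ _).1 = q.1
      rw [hc]
    · show ((B.coordOf _ _).2 : ℝ) = q.2
      rw [hc]
  continuous_toFun := by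
    refine Continuous.prodMk ?_ ?_
    · exact continuous_fst.comp (B.Ψ.symm.continuous.comp (continuous_subtype_val.subtype_mk _))
    · exact (continuous_subtype_val.comp (continuous_snd.comp
        (B.Ψ.symm.continuous.comp (continuous_subtype_val.subtype_mk _)))).subtype_mk _
  continuous_invFun := (continuous_subtype_val.comp (B.Ψ.continuous.comp
    (continuous_fst.prodMk ((continuous_subtype_val.comp continuous_snd).subtype_mk _)))).subtype_mk _

/-- The coordinates of a point of `N₋` (interval coordinate in `(-1, 0)`). [folklore] -/
def minusCoord (x : ↥B.cutData.minus) : ↥{x | f x = Circle.exp 0} × Ioo (-1 : ℝ) 0 :=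
  ((B.coordOf x (B.mem_minus_iff'.1 x.2).1).1,
    ⟨(B.coordOf x (B.mem_minus_iff'.1 x.2).1).2, by
      have h := B.pi_mul_snd_coordOf x (B.mem_minus_iff'.1 x.2).1
      have hneg := (B.mem_minus_iff'.1 x.2).2
      refine ⟨(B.coordOf x (B.mem_minus_iff'.1 x.2).1).2.2.1, ?_⟩
      by_contra hle
      have : 0 ≤ π * ((B.coordOf x (B.mem_minus_iff'.1 x.2).1).2 : ℝ) :=
        mul_nonneg Real.pi_pos.le (not_lt.1 hle)
      linarith⟩)

/-- The point of `N₋` with given coordinates. [folklore] -/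
def minusPoint (q : ↥{x | f x = Circle.exp 0} × Ioo (-1 : ℝ) 0) : ↥B.cutData.minus :=
  ⟨B.Ψ (q.1, ⟨q.2.1, q.2.2.1, by linarith [q.2.2.2]⟩), by
    rw [mem_minus_iff', B.lam_Ψ]
    exact ⟨(B.Ψ _).2, mul_neg_of_pos_of_neg Real.pi_pos q.2.2.2⟩⟩

/-- **`N₋ ≃ₜ L × (-1, 0)`.** [folklore] -/
def homeoMinus : ↥B.cutData.minus ≃ₜ ↥{x | f x = Circle.exp 0} × Ioo (-1 : ℝ) 0 where
  toFun := B.minusCoord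
  invFun := B.minusPoint
  left_inv x := by
    apply Subtype.ext
    change (B.Ψ (_, _) : X) = x
    rw [show ((B.minusCoord x).1, (⟨((B.minusCoord x).2 : ℝ), (B.minusCoord x).2.2.1, by linarith [(B.minusCoord x).2.2.2]⟩ :
        Ioo (-1 : ℝ) 1)) = B.coordOf x (B.mem_minus_iff'.1 x.2).1 from Prod.ext rfl (Subtype.ext rfl)]
    exact B.Ψ_coordOf x _
  right_inv q := by
    have hc : B.coordOf (B.minusPoint q : X) (B.mem_minus_iff'.1 (B.minusPoint q).2).1 =
        (q.1, ⟨q.2.1, q.2.2.1, by linarith [q.2.2.2]⟩) := B.coordOf_Ψ _ _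
    refine Prod.ext ?_ (Subtype.ext ?_)
    · show (B.coordOf _ _).1 = q.1
      rw [hc]
    · show ((B.coordOf _ _).2 : ℝ) = q.2
      rw [hc]
  continuous_toFun := by
    refine Continuous.prodMk ?_ ?_
    · exact continuous_fst.comp (B.Ψ.symm.continuous.comp (continuous_subtype_val.subtype_mk _))
    · exact (continuous_subtype_val.comp (continuous_snd.comp
        (B.Ψ.symm.continuous.comp (continuous_subtype_val.subtype_mk _)))).subtype_mk _
  continuous_invFun := (continuous_subtype_val.comp (B.Ψ.continuous.comp
    (continuous_fst.prodMk ((continuous_subtype_val.comp continuous_snd).subtype_mk _)))).subtype_mk _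

/-- The inclusion `N₊ ↪ N` in coordinates. [folklore] -/
theorem homeoN_comp_inclusion_plus :
    (B.homeoN : C(↥B.cutData.N, ↥{x | f x = Circle.exp 0} × Ioo (-1 : ℝ) 1)).comp
        (subsetInclusion B.cutData.plus_subset_N) =
      (BandData.inclIoo (a := -1) (b := 1) (c := 0) (d := 1) ↥{x | f x = Circle.exp 0} (by norm_num) le_rfl).comp
        (B.homeoPlus : C(↥B.cutData.plus, ↥{x | f x = Circle.exp 0} × Ioo (0 : ℝ) 1)) := by
  ext x : 1
  exact Prod.ext rfl (Subtype.ext rfl)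

/-- The inclusion `N₋ ↪ N` in coordinates. [folklore] -/
theorem homeoN_comp_inclusion_minus :
    (B.homeoN : C(↥B.cutData.N, ↥{x | f x = Circle.exp 0} × Ioo (-1 : ℝ) 1)).comp
        (subsetInclusion B.cutData.minus_subset_N) =
      (BandData.inclIoo (a := -1) (b := 1) (c := -1) (d := 0) ↥{x | f x = Circle.exp 0} le_rfl (by norm_num)).comp
        (B.homeoMinus : C(↥B.cutData.minus, ↥{x | f x = Circle.exp 0} × Ioo (-1 : ℝ) 0)) := by
  ext x : 1
  exact Prod.ext rfl (Subtype.ext rfl)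

/-! ### The homological hypotheses of the presentation -/

variable (R : Type) [CommRing R] (M : Type) [AddCommGroup M] [Module R M]

/-- **`N₊` is path connected** when the cut `L = {f = 1}` is. [folklore] -/
theorem pathConnectedSpace_plus [PathConnectedSpace ↥{x | f x = Circle.exp 0}] :
    PathConnectedSpace ↥B.cutData.plus :=
  haveI := BandData.pathConnectedSpace_Ioo (zero_lt_one' ℝ)
  BandData.pathConnectedSpace_of_homeomorph B.homeoPlus.symm

/-- **`N₋` is path connected** when the cut is. [folklore] -/
theorem pathConnectedSpace_minus [PathConnectedSpace ↥{x | f x = Circle.exp 0}] :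
    PathConnectedSpace ↥B.cutData.minus :=
  haveI := BandData.pathConnectedSpace_Ioo (show (-1 : ℝ) < 0 by norm_num)
  BandData.pathConnectedSpace_of_homeomorph B.homeoMinus.symm

/-- **Hypothesis `hεp`.** [folklore] -/
theorem ε_plus_injective [PathConnectedSpace ↥{x | f x = Circle.exp 0}] :
    Injective (singularHomology.ε R M ↥B.cutData.plus) :=
  haveI := B.pathConnectedSpace_plus
  CutData.ε_injective_of_pathConnectedSpace (R := R) (M := M) (P := ↥B.cutData.plus)

/-- **Hypothesis `hεm`.** [folklore] -/
theorem ε_minus_injective [PathConnectedSpace ↥{x | f x = Circle.exp 0}] :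
    Injective (singularHomology.ε R M ↥B.cutData.minus) :=
  haveI := B.pathConnectedSpace_minus
  CutData.ε_injective_of_pathConnectedSpace (R := R) (M := M) (P := ↥B.cutData.minus)

/-- **Hypotheses `hjs`, `hjpi`**: `j₊` is bijective. [cite: Rolfsen1976, §8.C] -/
theorem jPlus_bijective (n : ℕ) : Bijective (B.cutData.jPlus R M n) :=
  BandData.bijective_map_of_square R M _ _ B.homeoPlus B.homeoN B.homeoN_comp_inclusion_plus n
    (BandData.bijective_map_inclIoo _ R M _ _ (zero_lt_one' ℝ) n)

/-- **Hypothesis `hjmi`** (and more): `j₋` is bijective. [cite: Rolfsen1976, §8.C] -/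
theorem jMinus_bijective (n : ℕ) : Bijective (B.cutData.jMinus R M n) :=
  BandData.bijective_map_of_square R M _ _ B.homeoMinus B.homeoN B.homeoN_comp_inclusion_minus n
    (BandData.bijective_map_inclIoo _ R M _ _ (show (-1 : ℝ) < 0 by norm_num) n)

end CircleBandData

end CyclicCover

end CircleMaps

end Literature.Topology.FourManifolds
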